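import Summits.CriticalPhenomena.PercolationContinuityZ3.Theorems.Transplant.FKDoubleFanMultifanC2CertA
import Summits.CriticalPhenomena.PercolationContinuityZ3.Theorems.Transplant.FKDoubleFanMultifanC2CertB
import Summits.CriticalPhenomena.PercolationContinuityZ3.Theorems.Transplant.FKDoubleFanMultifanC2CertC
import HarnessLib

/-!
# Double fans, MULTIFAN₁ middles: `𝒞₂ ≥ 0` — the CORE-sized floor×roof³ coefficient of LEMMA‴ (assembly of the certificate)

Helper file (`--supports stmt-CriticalPhenomena-4575`), FK sub-lane `prim-bschramm-fk-3` (gen 34); builds on p205010 (kernel theorem, internal audit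
signed; external expert review pending).  Pure real polynomial algebra, no sorries; standard axioms.  Memo `bschramm/prim-bschramm-fk-3/FAR-CROSS-IX.md` §6–§6g.

`mfCtwo q t_g w_g t_u w_u t_s w_s` is the polynomial `𝒞₂` (374 terms): the coefficient of `X_f·y_f` in the endpoint cell (floor `a`-fan `F = (0, y_f, Z_f, X_f, r_f)`,
roof `b`-fan `(t_g, w_g)`, roof input `(t_u, w_u)`, roof target `(t_s, w_s)`) of the four-leg Rayleigh difference of `…DoubleFanMultifan` (the cell is
`𝒜·Z_f(Z_f+r_f+X_f) + 𝒩·X_f(X_f+r_f+Z_f) + 𝒞₁·Z_f y_f + 𝒞₂·X_f y_f`, `𝒜` = gen 33's CORE).  THE CERTIFICATE (**`mfCtwo_decomp`**, one `ring`):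
  `𝒞₂ = 4(1−q)²·[(α + m₂)² + q·t_g·α²] + Σ_e t_g^{e₁} t_u^{e₂} t_s^{e₃}·R_e`,  `α = t_s w_g + t_u(w_g − w_s)`,  `m₂ = w_g(1−w_s)(1−w_u)`,
with the twenty remainder coefficients `R_e = mfCtwoR…` of `…MultifanC2CertA/B/C`, each `≥ 0` on `[0,1]⁴`; hence **`mfCtwo_nonneg`**: `𝒞₂ ≥ 0` for `t ≥ 0`,
`q, w ∈ [0,1]`.  (At `q = 0` this is the rank-one square `4(α+m₂)²` plus a non-negative affine-in-`t` remainder; at `q = 1` the polynomial is divisible by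
`(1+t_g)(1+t_u)(1+t_s)`.)
[folklore]
-/

noncomputable section

namespace Summit.CriticalPhenomena.PercolationContinuityZ3.Theorems

namespace FK

namespace ThreeApex

/-- Coefficient of `t_g^0 t_u^0 t_s^0` in `𝒞₂` (polynomial in `q, wg, wu, ws`). [folklore] -/
def mfCtwoC000 (q wg wu ws : ℝ) : ℝ :=
  ((-1) : ℝ) * q ^ 3 * wg ^ 2 * ws ^ 2 * wu ^ 2 + (6 : ℝ) * q ^ 2 * wg ^ 2 * ws ^ 2 * wu ^ 2 + ((-8) : ℝ) * q * wg ^ 2 * ws ^ 2 * wu ^ 2 + ((-2) : ℝ) * q ^ 2 * wg * ws ^ 2 * wu ^ 2 +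
    ((-2) : ℝ) * q ^ 2 * wg ^ 2 * ws * wu ^ 2 + (1 : ℝ) * q ^ 3 * wg ^ 2 * ws ^ 2 + (1 : ℝ) * q ^ 3 * wg ^ 2 * wu ^ 2 + (4 : ℝ) * q * wg * ws ^ 2 * wu ^ 2 +
    (4 : ℝ) * q * wg ^ 2 * ws * wu ^ 2 + (4 : ℝ) * q ^ 2 * wg * ws * wu ^ 2 + ((-5) : ℝ) * q ^ 2 * wg ^ 2 * ws ^ 2 + ((-5) : ℝ) * q ^ 2 * wg ^ 2 * wu ^ 2 +
    ((-12) : ℝ) * q * wg * ws * wu ^ 2 + (8 : ℝ) * q * wg ^ 2 * ws ^ 2 + (8 : ℝ) * q * wg ^ 2 * wu ^ 2 + ((-1) : ℝ) * q ^ 3 * wg ^ 2 + (5 : ℝ) * q ^ 2 * wg ^ 2 +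
    (8 : ℝ) * wg * ws * wu ^ 2 + ((-4) : ℝ) * wg ^ 2 * ws ^ 2 + ((-4) : ℝ) * wg ^ 2 * wu ^ 2 + ((-8) : ℝ) * q * wg ^ 2 + (4 : ℝ) * wg ^ 2

/-- Coefficient of `t_g^0 t_u^0 t_s^1` in `𝒞₂` (polynomial in `q, wg, wu, ws`). [folklore] -/
def mfCtwoC001 (q wg wu ws : ℝ) : ℝ :=
  ((-1) : ℝ) * q ^ 3 * wg ^ 2 * ws ^ 2 * wu ^ 2 + (6 : ℝ) * q ^ 2 * wg ^ 2 * ws ^ 2 * wu ^ 2 + ((-8) : ℝ) * q * wg ^ 2 * ws ^ 2 * wu ^ 2 + ((-2) : ℝ) * q ^ 2 * wg * ws ^ 2 * wu ^ 2 +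
    ((-2) : ℝ) * q ^ 2 * wg ^ 2 * ws * wu ^ 2 + (1 : ℝ) * q ^ 3 * wg ^ 2 * ws ^ 2 + (2 : ℝ) * q ^ 3 * wg ^ 2 * wu ^ 2 + (4 : ℝ) * q * wg * ws ^ 2 * wu ^ 2 +
    (4 : ℝ) * q * wg ^ 2 * ws * wu ^ 2 + (4 : ℝ) * q ^ 2 * wg * ws * wu ^ 2 + ((-5) : ℝ) * q ^ 2 * wg ^ 2 * ws ^ 2 + ((-9) : ℝ) * q ^ 2 * wg ^ 2 * wu ^ 2 +
    ((-12) : ℝ) * q * wg * ws * wu ^ 2 + (8 : ℝ) * q * wg ^ 2 * ws ^ 2 + (12 : ℝ) * q * wg ^ 2 * wu ^ 2 + ((-2) : ℝ) * q ^ 3 * wg ^ 2 + (10 : ℝ) * q ^ 2 * wg ^ 2 +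
    (8 : ℝ) * wg * ws * wu ^ 2 + ((-4) : ℝ) * wg ^ 2 * ws ^ 2 + ((-4) : ℝ) * wg ^ 2 * wu ^ 2 + ((-16) : ℝ) * q * wg ^ 2 + (8 : ℝ) * wg ^ 2

/-- Coefficient of `t_g^0 t_u^0 t_s^2` in `𝒞₂` (polynomial in `q, wg, wu`). [folklore] -/
def mfCtwoC002 (q wg wu : ℝ) : ℝ :=
  (1 : ℝ) * q ^ 3 * wg ^ 2 * wu ^ 2 + ((-4) : ℝ) * q ^ 2 * wg ^ 2 * wu ^ 2 + (4 : ℝ) * q * wg ^ 2 * wu ^ 2 + ((-1) : ℝ) * q ^ 3 * wg ^ 2 + (5 : ℝ) * q ^ 2 * wg ^ 2 +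
    ((-8) : ℝ) * q * wg ^ 2 + (4 : ℝ) * wg ^ 2

/-- Coefficient of `t_g^0 t_u^1 t_s^0` in `𝒞₂` (polynomial in `q, wg, wu, ws`). [folklore] -/
def mfCtwoC010 (q wg wu ws : ℝ) : ℝ :=
  ((-1) : ℝ) * q ^ 3 * wg ^ 2 * ws ^ 2 * wu ^ 2 + (6 : ℝ) * q ^ 2 * wg ^ 2 * ws ^ 2 * wu ^ 2 + ((-8) : ℝ) * q * wg ^ 2 * ws ^ 2 * wu ^ 2 + ((-2) : ℝ) * q ^ 2 * wg * ws ^ 2 * wu ^ 2 +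
    ((-2) : ℝ) * q ^ 2 * wg ^ 2 * ws * wu ^ 2 + (3 : ℝ) * q ^ 3 * wg ^ 2 * ws ^ 2 + (1 : ℝ) * q ^ 3 * wg ^ 2 * wu ^ 2 + (1 : ℝ) * q ^ 3 * ws ^ 2 * wu ^ 2 +
    (4 : ℝ) * q * wg * ws ^ 2 * wu ^ 2 + (4 : ℝ) * q * wg ^ 2 * ws * wu ^ 2 + (4 : ℝ) * q ^ 2 * wg * ws * wu ^ 2 + ((-11) : ℝ) * q ^ 2 * wg ^ 2 * ws ^ 2 +
    ((-5) : ℝ) * q ^ 2 * wg ^ 2 * wu ^ 2 + ((-5) : ℝ) * q ^ 2 * ws ^ 2 * wu ^ 2 + ((-2) : ℝ) * q ^ 3 * wg * ws ^ 2 + ((-2) : ℝ) * q ^ 3 * wg ^ 2 * ws +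
    ((-12) : ℝ) * q * wg * ws * wu ^ 2 + (12 : ℝ) * q * wg ^ 2 * ws ^ 2 + (8 : ℝ) * q * wg ^ 2 * wu ^ 2 + (8 : ℝ) * q * ws ^ 2 * wu ^ 2 + (6 : ℝ) * q ^ 2 * wg * ws ^ 2 +
    (6 : ℝ) * q ^ 2 * wg ^ 2 * ws + (4 : ℝ) * q ^ 3 * wg * ws + ((-2) : ℝ) * q ^ 3 * wg ^ 2 + ((-1) : ℝ) * q ^ 3 * ws ^ 2 + ((-4) : ℝ) * q * wg * ws ^ 2 +
    ((-4) : ℝ) * q * wg ^ 2 * ws + ((-16) : ℝ) * q ^ 2 * wg * ws + (10 : ℝ) * q ^ 2 * wg ^ 2 + (5 : ℝ) * q ^ 2 * ws ^ 2 + (8 : ℝ) * wg * ws * wu ^ 2 + ((-4) : ℝ) * wg ^ 2 * ws ^ 2 +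
    ((-4) : ℝ) * wg ^ 2 * wu ^ 2 + ((-4) : ℝ) * ws ^ 2 * wu ^ 2 + (20 : ℝ) * q * wg * ws + ((-16) : ℝ) * q * wg ^ 2 + ((-8) : ℝ) * q * ws ^ 2 + ((-8) : ℝ) * wg * ws +
    (8 : ℝ) * wg ^ 2 + (4 : ℝ) * ws ^ 2

/-- Coefficient of `t_g^0 t_u^1 t_s^1` in `𝒞₂` (polynomial in `q, wg, wu, ws`). [folklore] -/
def mfCtwoC011 (q wg wu ws : ℝ) : ℝ :=
  ((-1) : ℝ) * q ^ 4 * wg ^ 2 * ws ^ 2 * wu ^ 2 + (6 : ℝ) * q ^ 3 * wg ^ 2 * ws ^ 2 * wu ^ 2 + ((-8) : ℝ) * q ^ 2 * wg ^ 2 * ws ^ 2 * wu ^ 2 +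
    ((-2) : ℝ) * q ^ 3 * wg * ws ^ 2 * wu ^ 2 + ((-2) : ℝ) * q ^ 3 * wg ^ 2 * ws * wu ^ 2 + (1 : ℝ) * q ^ 4 * wg ^ 2 * ws ^ 2 + (1 : ℝ) * q ^ 4 * wg ^ 2 * wu ^ 2 +
    (1 : ℝ) * q ^ 4 * ws ^ 2 * wu ^ 2 + (4 : ℝ) * q ^ 2 * wg * ws ^ 2 * wu ^ 2 + (4 : ℝ) * q ^ 2 * wg ^ 2 * ws * wu ^ 2 + (4 : ℝ) * q ^ 3 * wg * ws * wu ^ 2 +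
    ((-3) : ℝ) * q ^ 3 * wg ^ 2 * ws ^ 2 + ((-4) : ℝ) * q ^ 3 * wg ^ 2 * wu ^ 2 + ((-5) : ℝ) * q ^ 3 * ws ^ 2 * wu ^ 2 + ((-12) : ℝ) * q ^ 2 * wg * ws * wu ^ 2 +
    (2 : ℝ) * q ^ 2 * wg ^ 2 * ws ^ 2 + (4 : ℝ) * q ^ 2 * wg ^ 2 * wu ^ 2 + (8 : ℝ) * q ^ 2 * ws ^ 2 * wu ^ 2 + ((-2) : ℝ) * q ^ 3 * wg * ws ^ 2 + ((-2) : ℝ) * q ^ 3 * wg ^ 2 * ws +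
    ((-1) : ℝ) * q ^ 4 * wg ^ 2 + ((-1) : ℝ) * q ^ 4 * ws ^ 2 + (8 : ℝ) * q * wg * ws * wu ^ 2 + ((-4) : ℝ) * q * ws ^ 2 * wu ^ 2 + (6 : ℝ) * q ^ 2 * wg * ws ^ 2 +
    (6 : ℝ) * q ^ 2 * wg ^ 2 * ws + (4 : ℝ) * q ^ 3 * wg * ws + (3 : ℝ) * q ^ 3 * wg ^ 2 + (5 : ℝ) * q ^ 3 * ws ^ 2 + ((-4) : ℝ) * q * wg * ws ^ 2 + ((-4) : ℝ) * q * wg ^ 2 * ws +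
    ((-16) : ℝ) * q ^ 2 * wg * ws + (2 : ℝ) * q ^ 2 * wg ^ 2 + ((-8) : ℝ) * q ^ 2 * ws ^ 2 + (20 : ℝ) * q * wg * ws + ((-12) : ℝ) * q * wg ^ 2 + (4 : ℝ) * q * ws ^ 2 +
    ((-8) : ℝ) * wg * ws + (8 : ℝ) * wg ^ 2

/-- Coefficient of `t_g^0 t_u^1 t_s^2` in `𝒞₂` (polynomial in `q, wg, wu`). [folklore] -/
def mfCtwoC012 (q wg wu : ℝ) : ℝ :=
  (1 : ℝ) * q ^ 4 * wg ^ 2 * wu ^ 2 + ((-4) : ℝ) * q ^ 3 * wg ^ 2 * wu ^ 2 + (4 : ℝ) * q ^ 2 * wg ^ 2 * wu ^ 2 + ((-1) : ℝ) * q ^ 4 * wg ^ 2 + (5 : ℝ) * q ^ 3 * wg ^ 2 +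
    ((-8) : ℝ) * q ^ 2 * wg ^ 2 + (4 : ℝ) * q * wg ^ 2

/-- Coefficient of `t_g^0 t_u^2 t_s^0` in `𝒞₂` (polynomial in `q, wg, ws`). [folklore] -/
def mfCtwoC020 (q wg ws : ℝ) : ℝ :=
  (2 : ℝ) * q ^ 3 * wg ^ 2 * ws ^ 2 + ((-6) : ℝ) * q ^ 2 * wg ^ 2 * ws ^ 2 + ((-2) : ℝ) * q ^ 3 * wg * ws ^ 2 + ((-2) : ℝ) * q ^ 3 * wg ^ 2 * ws + (4 : ℝ) * q * wg ^ 2 * ws ^ 2 +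
    (6 : ℝ) * q ^ 2 * wg * ws ^ 2 + (6 : ℝ) * q ^ 2 * wg ^ 2 * ws + (4 : ℝ) * q ^ 3 * wg * ws + ((-1) : ℝ) * q ^ 3 * wg ^ 2 + ((-1) : ℝ) * q ^ 3 * ws ^ 2 +
    ((-4) : ℝ) * q * wg * ws ^ 2 + ((-4) : ℝ) * q * wg ^ 2 * ws + ((-16) : ℝ) * q ^ 2 * wg * ws + (5 : ℝ) * q ^ 2 * wg ^ 2 + (5 : ℝ) * q ^ 2 * ws ^ 2 + (20 : ℝ) * q * wg * ws +
    ((-8) : ℝ) * q * wg ^ 2 + ((-8) : ℝ) * q * ws ^ 2 + ((-8) : ℝ) * wg * ws + (4 : ℝ) * wg ^ 2 + (4 : ℝ) * ws ^ 2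

/-- Coefficient of `t_g^0 t_u^2 t_s^1` in `𝒞₂` (polynomial in `q, wg, ws`). [folklore] -/
def mfCtwoC021 (q wg ws : ℝ) : ℝ :=
  (2 : ℝ) * q ^ 4 * wg ^ 2 * ws ^ 2 + ((-6) : ℝ) * q ^ 3 * wg ^ 2 * ws ^ 2 + ((-2) : ℝ) * q ^ 4 * wg * ws ^ 2 + ((-2) : ℝ) * q ^ 4 * wg ^ 2 * ws + (4 : ℝ) * q ^ 2 * wg ^ 2 * ws ^ 2 +
    (6 : ℝ) * q ^ 3 * wg * ws ^ 2 + (6 : ℝ) * q ^ 3 * wg ^ 2 * ws + (4 : ℝ) * q ^ 4 * wg * ws + ((-1) : ℝ) * q ^ 4 * wg ^ 2 + ((-1) : ℝ) * q ^ 4 * ws ^ 2 +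
    ((-4) : ℝ) * q ^ 2 * wg * ws ^ 2 + ((-4) : ℝ) * q ^ 2 * wg ^ 2 * ws + ((-16) : ℝ) * q ^ 3 * wg * ws + (5 : ℝ) * q ^ 3 * wg ^ 2 + (5 : ℝ) * q ^ 3 * ws ^ 2 +
    (20 : ℝ) * q ^ 2 * wg * ws + ((-8) : ℝ) * q ^ 2 * wg ^ 2 + ((-8) : ℝ) * q ^ 2 * ws ^ 2 + ((-8) : ℝ) * q * wg * ws + (4 : ℝ) * q * wg ^ 2 + (4 : ℝ) * q * ws ^ 2

/-- Coefficient of `t_g^1 t_u^0 t_s^0` in `𝒞₂` (polynomial in `q, wg, wu, ws`). [folklore] -/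
def mfCtwoC100 (q wg wu ws : ℝ) : ℝ :=
  ((-1) : ℝ) * q ^ 4 * wg ^ 2 * ws ^ 2 * wu ^ 2 + (6 : ℝ) * q ^ 3 * wg ^ 2 * ws ^ 2 * wu ^ 2 + ((-8) : ℝ) * q ^ 2 * wg ^ 2 * ws ^ 2 * wu ^ 2 +
    ((-2) : ℝ) * q ^ 3 * wg * ws ^ 2 * wu ^ 2 + ((-2) : ℝ) * q ^ 3 * wg ^ 2 * ws * wu ^ 2 + (1 : ℝ) * q ^ 4 * wg ^ 2 * ws ^ 2 + (1 : ℝ) * q ^ 4 * wg ^ 2 * wu ^ 2 +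
    (4 : ℝ) * q ^ 2 * wg * ws ^ 2 * wu ^ 2 + (4 : ℝ) * q ^ 2 * wg ^ 2 * ws * wu ^ 2 + (4 : ℝ) * q ^ 3 * wg * ws * wu ^ 2 + ((-5) : ℝ) * q ^ 3 * wg ^ 2 * ws ^ 2 +
    ((-5) : ℝ) * q ^ 3 * wg ^ 2 * wu ^ 2 + ((-12) : ℝ) * q ^ 2 * wg * ws * wu ^ 2 + (8 : ℝ) * q ^ 2 * wg ^ 2 * ws ^ 2 + (8 : ℝ) * q ^ 2 * wg ^ 2 * wu ^ 2 +
    (1 : ℝ) * q ^ 2 * ws ^ 2 * wu ^ 2 + ((-1) : ℝ) * q ^ 4 * wg ^ 2 + (8 : ℝ) * q * wg * ws * wu ^ 2 + ((-4) : ℝ) * q * wg ^ 2 * ws ^ 2 + ((-4) : ℝ) * q * wg ^ 2 * wu ^ 2 +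
    ((-4) : ℝ) * q * ws ^ 2 * wu ^ 2 + (5 : ℝ) * q ^ 3 * wg ^ 2 + ((-8) : ℝ) * q ^ 2 * wg ^ 2 + (4 : ℝ) * ws ^ 2 * wu ^ 2 + (4 : ℝ) * q * wg ^ 2

/-- Coefficient of `t_g^1 t_u^0 t_s^1` in `𝒞₂` (polynomial in `q, wg, wu, ws`). [folklore] -/
def mfCtwoC101 (q wg wu ws : ℝ) : ℝ :=
  ((-1) : ℝ) * q ^ 4 * wg ^ 2 * ws ^ 2 * wu ^ 2 + (6 : ℝ) * q ^ 3 * wg ^ 2 * ws ^ 2 * wu ^ 2 + ((-8) : ℝ) * q ^ 2 * wg ^ 2 * ws ^ 2 * wu ^ 2 +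
    ((-2) : ℝ) * q ^ 3 * wg * ws ^ 2 * wu ^ 2 + ((-2) : ℝ) * q ^ 3 * wg ^ 2 * ws * wu ^ 2 + (1 : ℝ) * q ^ 4 * wg ^ 2 * ws ^ 2 + (2 : ℝ) * q ^ 4 * wg ^ 2 * wu ^ 2 +
    (4 : ℝ) * q ^ 2 * wg * ws ^ 2 * wu ^ 2 + (4 : ℝ) * q ^ 2 * wg ^ 2 * ws * wu ^ 2 + (4 : ℝ) * q ^ 3 * wg * ws * wu ^ 2 + ((-5) : ℝ) * q ^ 3 * wg ^ 2 * ws ^ 2 +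
    ((-9) : ℝ) * q ^ 3 * wg ^ 2 * wu ^ 2 + (1 : ℝ) * q ^ 3 * ws ^ 2 * wu ^ 2 + ((-12) : ℝ) * q ^ 2 * wg * ws * wu ^ 2 + (8 : ℝ) * q ^ 2 * wg ^ 2 * ws ^ 2 +
    (12 : ℝ) * q ^ 2 * wg ^ 2 * wu ^ 2 + ((-4) : ℝ) * q ^ 2 * ws ^ 2 * wu ^ 2 + ((-2) : ℝ) * q ^ 4 * wg ^ 2 + (8 : ℝ) * q * wg * ws * wu ^ 2 + ((-4) : ℝ) * q * wg ^ 2 * ws ^ 2 +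
    ((-4) : ℝ) * q * wg ^ 2 * wu ^ 2 + (4 : ℝ) * q * ws ^ 2 * wu ^ 2 + (10 : ℝ) * q ^ 3 * wg ^ 2 + ((-16) : ℝ) * q ^ 2 * wg ^ 2 + (8 : ℝ) * q * wg ^ 2

/-- Coefficient of `t_g^1 t_u^0 t_s^2` in `𝒞₂` (polynomial in `q, wg, wu`). [folklore] -/
def mfCtwoC102 (q wg wu : ℝ) : ℝ :=
  (1 : ℝ) * q ^ 4 * wg ^ 2 * wu ^ 2 + ((-4) : ℝ) * q ^ 3 * wg ^ 2 * wu ^ 2 + (4 : ℝ) * q ^ 2 * wg ^ 2 * wu ^ 2 + ((-1) : ℝ) * q ^ 4 * wg ^ 2 + (5 : ℝ) * q ^ 3 * wg ^ 2 +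
    ((-8) : ℝ) * q ^ 2 * wg ^ 2 + (4 : ℝ) * q * wg ^ 2

/-- Coefficient of `t_g^1 t_u^1 t_s^0` in `𝒞₂` (polynomial in `q, wg, wu, ws`). [folklore] -/
def mfCtwoC110 (q wg wu ws : ℝ) : ℝ :=
  ((-1) : ℝ) * q ^ 4 * wg ^ 2 * ws ^ 2 * wu ^ 2 + (6 : ℝ) * q ^ 3 * wg ^ 2 * ws ^ 2 * wu ^ 2 + ((-8) : ℝ) * q ^ 2 * wg ^ 2 * ws ^ 2 * wu ^ 2 +
    ((-2) : ℝ) * q ^ 3 * wg * ws ^ 2 * wu ^ 2 + ((-2) : ℝ) * q ^ 3 * wg ^ 2 * ws * wu ^ 2 + (3 : ℝ) * q ^ 4 * wg ^ 2 * ws ^ 2 + (1 : ℝ) * q ^ 4 * wg ^ 2 * wu ^ 2 +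
    (1 : ℝ) * q ^ 4 * ws ^ 2 * wu ^ 2 + (4 : ℝ) * q ^ 2 * wg * ws ^ 2 * wu ^ 2 + (4 : ℝ) * q ^ 2 * wg ^ 2 * ws * wu ^ 2 + (4 : ℝ) * q ^ 3 * wg * ws * wu ^ 2 +
    ((-11) : ℝ) * q ^ 3 * wg ^ 2 * ws ^ 2 + ((-5) : ℝ) * q ^ 3 * wg ^ 2 * wu ^ 2 + ((-4) : ℝ) * q ^ 3 * ws ^ 2 * wu ^ 2 + ((-2) : ℝ) * q ^ 4 * wg * ws ^ 2 +
    ((-2) : ℝ) * q ^ 4 * wg ^ 2 * ws + ((-12) : ℝ) * q ^ 2 * wg * ws * wu ^ 2 + (12 : ℝ) * q ^ 2 * wg ^ 2 * ws ^ 2 + (8 : ℝ) * q ^ 2 * wg ^ 2 * wu ^ 2 +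
    (4 : ℝ) * q ^ 2 * ws ^ 2 * wu ^ 2 + (6 : ℝ) * q ^ 3 * wg * ws ^ 2 + (6 : ℝ) * q ^ 3 * wg ^ 2 * ws + (4 : ℝ) * q ^ 4 * wg * ws + ((-2) : ℝ) * q ^ 4 * wg ^ 2 +
    ((-1) : ℝ) * q ^ 4 * ws ^ 2 + (8 : ℝ) * q * wg * ws * wu ^ 2 + ((-4) : ℝ) * q * wg ^ 2 * ws ^ 2 + ((-4) : ℝ) * q * wg ^ 2 * wu ^ 2 + ((-4) : ℝ) * q ^ 2 * wg * ws ^ 2 +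
    ((-4) : ℝ) * q ^ 2 * wg ^ 2 * ws + ((-16) : ℝ) * q ^ 3 * wg * ws + (10 : ℝ) * q ^ 3 * wg ^ 2 + (5 : ℝ) * q ^ 3 * ws ^ 2 + (20 : ℝ) * q ^ 2 * wg * ws +
    ((-16) : ℝ) * q ^ 2 * wg ^ 2 + ((-8) : ℝ) * q ^ 2 * ws ^ 2 + ((-8) : ℝ) * q * wg * ws + (8 : ℝ) * q * wg ^ 2 + (4 : ℝ) * q * ws ^ 2

/-- Coefficient of `t_g^1 t_u^1 t_s^1` in `𝒞₂` (polynomial in `q, wg, wu, ws`). [folklore] -/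
def mfCtwoC111 (q wg wu ws : ℝ) : ℝ :=
  ((-1) : ℝ) * q ^ 5 * wg ^ 2 * ws ^ 2 * wu ^ 2 + (6 : ℝ) * q ^ 4 * wg ^ 2 * ws ^ 2 * wu ^ 2 + ((-8) : ℝ) * q ^ 3 * wg ^ 2 * ws ^ 2 * wu ^ 2 +
    ((-2) : ℝ) * q ^ 4 * wg * ws ^ 2 * wu ^ 2 + ((-2) : ℝ) * q ^ 4 * wg ^ 2 * ws * wu ^ 2 + (1 : ℝ) * q ^ 5 * wg ^ 2 * ws ^ 2 + (1 : ℝ) * q ^ 5 * wg ^ 2 * wu ^ 2 +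
    (1 : ℝ) * q ^ 5 * ws ^ 2 * wu ^ 2 + (4 : ℝ) * q ^ 3 * wg * ws ^ 2 * wu ^ 2 + (4 : ℝ) * q ^ 3 * wg ^ 2 * ws * wu ^ 2 + (4 : ℝ) * q ^ 4 * wg * ws * wu ^ 2 +
    ((-3) : ℝ) * q ^ 4 * wg ^ 2 * ws ^ 2 + ((-4) : ℝ) * q ^ 4 * wg ^ 2 * wu ^ 2 + ((-4) : ℝ) * q ^ 4 * ws ^ 2 * wu ^ 2 + ((-12) : ℝ) * q ^ 3 * wg * ws * wu ^ 2 +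
    (2 : ℝ) * q ^ 3 * wg ^ 2 * ws ^ 2 + (4 : ℝ) * q ^ 3 * wg ^ 2 * wu ^ 2 + (4 : ℝ) * q ^ 3 * ws ^ 2 * wu ^ 2 + ((-2) : ℝ) * q ^ 4 * wg * ws ^ 2 + ((-2) : ℝ) * q ^ 4 * wg ^ 2 * ws +
    ((-1) : ℝ) * q ^ 5 * wg ^ 2 + ((-1) : ℝ) * q ^ 5 * ws ^ 2 + (8 : ℝ) * q ^ 2 * wg * ws * wu ^ 2 + (6 : ℝ) * q ^ 3 * wg * ws ^ 2 + (6 : ℝ) * q ^ 3 * wg ^ 2 * ws +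
    (4 : ℝ) * q ^ 4 * wg * ws + (3 : ℝ) * q ^ 4 * wg ^ 2 + (5 : ℝ) * q ^ 4 * ws ^ 2 + ((-4) : ℝ) * q ^ 2 * wg * ws ^ 2 + ((-4) : ℝ) * q ^ 2 * wg ^ 2 * ws +
    ((-16) : ℝ) * q ^ 3 * wg * ws + (2 : ℝ) * q ^ 3 * wg ^ 2 + ((-8) : ℝ) * q ^ 3 * ws ^ 2 + (20 : ℝ) * q ^ 2 * wg * ws + ((-12) : ℝ) * q ^ 2 * wg ^ 2 + (4 : ℝ) * q ^ 2 * ws ^ 2 +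
    ((-8) : ℝ) * q * wg * ws + (8 : ℝ) * q * wg ^ 2

/-- Coefficient of `t_g^1 t_u^1 t_s^2` in `𝒞₂` (polynomial in `q, wg, wu`). [folklore] -/
def mfCtwoC112 (q wg wu : ℝ) : ℝ :=
  (1 : ℝ) * q ^ 5 * wg ^ 2 * wu ^ 2 + ((-4) : ℝ) * q ^ 4 * wg ^ 2 * wu ^ 2 + (4 : ℝ) * q ^ 3 * wg ^ 2 * wu ^ 2 + ((-1) : ℝ) * q ^ 5 * wg ^ 2 + (5 : ℝ) * q ^ 4 * wg ^ 2 +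
    ((-8) : ℝ) * q ^ 3 * wg ^ 2 + (4 : ℝ) * q ^ 2 * wg ^ 2

/-- Coefficient of `t_g^1 t_u^2 t_s^0` in `𝒞₂` (polynomial in `q, wg, ws`). [folklore] -/
def mfCtwoC120 (q wg ws : ℝ) : ℝ :=
  (2 : ℝ) * q ^ 4 * wg ^ 2 * ws ^ 2 + ((-6) : ℝ) * q ^ 3 * wg ^ 2 * ws ^ 2 + ((-2) : ℝ) * q ^ 4 * wg * ws ^ 2 + ((-2) : ℝ) * q ^ 4 * wg ^ 2 * ws + (4 : ℝ) * q ^ 2 * wg ^ 2 * ws ^ 2 +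
    (6 : ℝ) * q ^ 3 * wg * ws ^ 2 + (6 : ℝ) * q ^ 3 * wg ^ 2 * ws + (4 : ℝ) * q ^ 4 * wg * ws + ((-1) : ℝ) * q ^ 4 * wg ^ 2 + ((-1) : ℝ) * q ^ 4 * ws ^ 2 +
    ((-4) : ℝ) * q ^ 2 * wg * ws ^ 2 + ((-4) : ℝ) * q ^ 2 * wg ^ 2 * ws + ((-16) : ℝ) * q ^ 3 * wg * ws + (5 : ℝ) * q ^ 3 * wg ^ 2 + (5 : ℝ) * q ^ 3 * ws ^ 2 +
    (20 : ℝ) * q ^ 2 * wg * ws + ((-8) : ℝ) * q ^ 2 * wg ^ 2 + ((-8) : ℝ) * q ^ 2 * ws ^ 2 + ((-8) : ℝ) * q * wg * ws + (4 : ℝ) * q * wg ^ 2 + (4 : ℝ) * q * ws ^ 2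

/-- Coefficient of `t_g^1 t_u^2 t_s^1` in `𝒞₂` (polynomial in `q, wg, ws`). [folklore] -/
def mfCtwoC121 (q wg ws : ℝ) : ℝ :=
  (2 : ℝ) * q ^ 5 * wg ^ 2 * ws ^ 2 + ((-6) : ℝ) * q ^ 4 * wg ^ 2 * ws ^ 2 + ((-2) : ℝ) * q ^ 5 * wg * ws ^ 2 + ((-2) : ℝ) * q ^ 5 * wg ^ 2 * ws + (4 : ℝ) * q ^ 3 * wg ^ 2 * ws ^ 2 +
    (6 : ℝ) * q ^ 4 * wg * ws ^ 2 + (6 : ℝ) * q ^ 4 * wg ^ 2 * ws + (4 : ℝ) * q ^ 5 * wg * ws + ((-1) : ℝ) * q ^ 5 * wg ^ 2 + ((-1) : ℝ) * q ^ 5 * ws ^ 2 +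
    ((-4) : ℝ) * q ^ 3 * wg * ws ^ 2 + ((-4) : ℝ) * q ^ 3 * wg ^ 2 * ws + ((-16) : ℝ) * q ^ 4 * wg * ws + (5 : ℝ) * q ^ 4 * wg ^ 2 + (5 : ℝ) * q ^ 4 * ws ^ 2 +
    (20 : ℝ) * q ^ 3 * wg * ws + ((-8) : ℝ) * q ^ 3 * wg ^ 2 + ((-8) : ℝ) * q ^ 3 * ws ^ 2 + ((-8) : ℝ) * q ^ 2 * wg * ws + (4 : ℝ) * q ^ 2 * wg ^ 2 + (4 : ℝ) * q ^ 2 * ws ^ 2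

/-- Coefficient of `t_g^2 t_u^0 t_s^0` in `𝒞₂` (polynomial in `q, wu, ws`). [folklore] -/
def mfCtwoC200 (q wu ws : ℝ) : ℝ :=
  (1 : ℝ) * q ^ 3 * ws ^ 2 * wu ^ 2 + ((-4) : ℝ) * q ^ 2 * ws ^ 2 * wu ^ 2 + (4 : ℝ) * q * ws ^ 2 * wu ^ 2

/-- Coefficient of `t_g^2 t_u^0 t_s^1` in `𝒞₂` (polynomial in `q, wu, ws`). [folklore] -/
def mfCtwoC201 (q wu ws : ℝ) : ℝ :=
  (1 : ℝ) * q ^ 4 * ws ^ 2 * wu ^ 2 + ((-4) : ℝ) * q ^ 3 * ws ^ 2 * wu ^ 2 + (4 : ℝ) * q ^ 2 * ws ^ 2 * wu ^ 2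

/-- Coefficient of `t_g^2 t_u^1 t_s^0` in `𝒞₂` (polynomial in `q, wu, ws`). [folklore] -/
def mfCtwoC210 (q wu ws : ℝ) : ℝ :=
  (1 : ℝ) * q ^ 4 * ws ^ 2 * wu ^ 2 + ((-4) : ℝ) * q ^ 3 * ws ^ 2 * wu ^ 2 + (4 : ℝ) * q ^ 2 * ws ^ 2 * wu ^ 2

/-- Coefficient of `t_g^2 t_u^1 t_s^1` in `𝒞₂` (polynomial in `q, wu, ws`). [folklore] -/
def mfCtwoC211 (q wu ws : ℝ) : ℝ :=
  (1 : ℝ) * q ^ 5 * ws ^ 2 * wu ^ 2 + ((-4) : ℝ) * q ^ 4 * ws ^ 2 * wu ^ 2 + (4 : ℝ) * q ^ 3 * ws ^ 2 * wu ^ 2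

/-- **`𝒞₂`**: the `X_f·y_f` coefficient of the floor×roof³ endpoint cell of LEMMA‴ (374 terms, grouped by its twenty `t`-monomials; degree `≤ 2` in each of
`t_g, w_g, t_u, w_u, t_s, w_s`, `5` in `q`). [folklore] -/
def mfCtwo (q tg wg tu wu ts ws : ℝ) : ℝ :=
  mfCtwoC000 q wg wu ws + ts * mfCtwoC001 q wg wu ws + ts ^ 2 * mfCtwoC002 q wg wu + tu * mfCtwoC010 q wg wu ws + tu * ts * mfCtwoC011 q wg wu ws +
    tu * ts ^ 2 * mfCtwoC012 q wg wu + tu ^ 2 * mfCtwoC020 q wg ws + tu ^ 2 * ts * mfCtwoC021 q wg ws + tg * mfCtwoC100 q wg wu ws + tg * ts * mfCtwoC101 q wg wu ws +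
    tg * ts ^ 2 * mfCtwoC102 q wg wu + tg * tu * mfCtwoC110 q wg wu ws + tg * tu * ts * mfCtwoC111 q wg wu ws + tg * tu * ts ^ 2 * mfCtwoC112 q wg wu +
    tg * tu ^ 2 * mfCtwoC120 q wg ws + tg * tu ^ 2 * ts * mfCtwoC121 q wg ws + tg ^ 2 * mfCtwoC200 q wu ws + tg ^ 2 * ts * mfCtwoC201 q wu ws +
    tg ^ 2 * tu * mfCtwoC210 q wu ws + tg ^ 2 * tu * ts * mfCtwoC211 q wu ws

set_option maxHeartbeats 16000000 in
/-- **The `𝒞₂` certificate identity**: rank-one square `+ q·t_g·α²`, times `4(1−q)²`, plus the twenty certified remainders. [folklore] -/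
theorem mfCtwo_decomp (q tg wg tu wu ts ws : ℝ) :
    mfCtwo q tg wg tu wu ts ws =
      4 * (1 - q) ^ 2 * ((ts * wg + tu * (wg - ws) + wg * (1 - ws) * (1 - wu)) ^ 2 + q * tg * (ts * wg + tu * (wg - ws)) ^ 2) +
      (mfCtwoR000 q wg wu ws + ts * mfCtwoR001 q wg wu ws + ts ^ 2 * mfCtwoR002 q wg wu + tu * mfCtwoR010 q wg wu ws + tu * ts * mfCtwoR011 q wg wu ws +
       tu * ts ^ 2 * mfCtwoR012 q wg wu + tu ^ 2 * mfCtwoR020 q wg ws + tu ^ 2 * ts * mfCtwoR021 q wg ws + tg * mfCtwoR100 q wg wu ws + tg * ts * mfCtwoR101 q wg wu ws +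
       tg * ts ^ 2 * mfCtwoR102 q wg wu + tg * tu * mfCtwoR110 q wg wu ws + tg * tu * ts * mfCtwoR111 q wg wu ws + tg * tu * ts ^ 2 * mfCtwoR112 q wg wu +
       tg * tu ^ 2 * mfCtwoR120 q wg ws + tg * tu ^ 2 * ts * mfCtwoR121 q wg ws + tg ^ 2 * mfCtwoR200 q wu ws + tg ^ 2 * ts * mfCtwoR201 q wu ws +
       tg ^ 2 * tu * mfCtwoR210 q wu ws + tg ^ 2 * tu * ts * mfCtwoR211 q wu ws) := by
  simp only [mfCtwo, mfCtwoC000, mfCtwoC001, mfCtwoC002, mfCtwoC010, mfCtwoC011, mfCtwoC012, mfCtwoC020, mfCtwoC021, mfCtwoC100, mfCtwoC101, mfCtwoC102, mfCtwoC110, mfCtwoC111, mfCtwoC112, mfCtwoC120, mfCtwoC121, mfCtwoC200, mfCtwoC201, mfCtwoC210, mfCtwoC211, mfCtwoR000, mfCtwoR001, mfCtwoR002, mfCtwoR010, mfCtwoR011, mfCtwoR012, mfCtwoR020, mfCtwoR021, mfCtwoR100, mfCtwoR101, mfCtwoR102, mfCtwoR110, mfCtwoR111, mfCtwoR112, mfCtwoR120,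 mfCtwoR121, mfCtwoR200, mfCtwoR201, mfCtwoR210, mfCtwoR211]
  ring

/-- **`𝒞₂ ≥ 0`** on `t_g, t_u, t_s ≥ 0`, `q, w_g, w_u, w_s ∈ [0,1]`. [folklore] -/
theorem mfCtwo_nonneg {q tg wg tu wu ts ws : ℝ} (hq0 : 0 ≤ q) (hq1 : q ≤ 1) (htg : 0 ≤ tg) (hwg0 : 0 ≤ wg) (hwg1 : wg ≤ 1) (htu : 0 ≤ tu)
    (hwu0 : 0 ≤ wu) (hwu1 : wu ≤ 1) (hts : 0 ≤ ts) (hws0 : 0 ≤ ws) (hws1 : ws ≤ 1) : 0 ≤ mfCtwo q tg wg tu wu ts ws := by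
  have h000 : 0 ≤ mfCtwoR000 q wg wu ws := mfCtwoR000_nonneg hq0 hq1 hwg0 hwg1 hwu0 hwu1 hws0 hws1
  have h001 : 0 ≤ mfCtwoR001 q wg wu ws := mfCtwoR001_nonneg hq0 hq1 hwg0 hwg1 hwu0 hwu1 hws0 hws1
  have h002 : 0 ≤ mfCtwoR002 q wg wu := mfCtwoR002_nonneg hq0 hq1 hwu0 hwu1
  have h010 : 0 ≤ mfCtwoR010 q wg wu ws := mfCtwoR010_nonneg hq0 hq1 hwg0 hwg1 hwu0 hwu1 hws0 hws1
  have h011 : 0 ≤ mfCtwoR011 q wg wu ws := mfCtwoR011_nonneg hq0 hq1 hwg0 hwg1 hwu0 hwu1 hws0 hws1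
  have h012 : 0 ≤ mfCtwoR012 q wg wu := mfCtwoR012_nonneg hq0 hq1 hwu0 hwu1
  have h020 : 0 ≤ mfCtwoR020 q wg ws := mfCtwoR020_nonneg hq0 hq1 hwg0 hwg1 hws0 hws1
  have h021 : 0 ≤ mfCtwoR021 q wg ws := mfCtwoR021_nonneg hq0 hq1 hwg0 hwg1 hws0 hws1
  have h100 : 0 ≤ mfCtwoR100 q wg wu ws := mfCtwoR100_nonneg hq0 hq1 hwg0 hwg1 hwu0 hwu1 hws0 hws1
  have h101 : 0 ≤ mfCtwoR101 q wg wu ws := mfCtwoR101_nonneg hq0 hq1 hwg0 hwg1 hwu0 hwu1 hws0 hws1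
  have h102 : 0 ≤ mfCtwoR102 q wg wu := mfCtwoR102_nonneg hq0 hq1 hwu0 hwu1
  have h110 : 0 ≤ mfCtwoR110 q wg wu ws := mfCtwoR110_nonneg hq0 hq1 hwg0 hwg1 hwu0 hwu1 hws0 hws1
  have h111 : 0 ≤ mfCtwoR111 q wg wu ws := mfCtwoR111_nonneg hq0 hq1 hwg0 hwg1 hwu0 hwu1 hws0 hws1
  have h112 : 0 ≤ mfCtwoR112 q wg wu := mfCtwoR112_nonneg hq0 hq1 hwu0 hwu1
  have h120 : 0 ≤ mfCtwoR120 q wg ws := mfCtwoR120_nonneg hq0 hq1 hwg0 hwg1 hws0 hws1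
  have h121 : 0 ≤ mfCtwoR121 q wg ws := mfCtwoR121_nonneg hq0 hq1 hwg0 hwg1 hws0 hws1
  have h200 : 0 ≤ mfCtwoR200 q wu ws := mfCtwoR200_nonneg hq0 hq1
  have h201 : 0 ≤ mfCtwoR201 q wu ws := mfCtwoR201_nonneg hq0 hq1
  have h210 : 0 ≤ mfCtwoR210 q wu ws := mfCtwoR210_nonneg hq0 hq1
  have h211 : 0 ≤ mfCtwoR211 q wu ws := mfCtwoR211_nonneg hq0 hq1
  rw [mfCtwo_decomp]
  positivity

end ThreeApex

end FK

end Summit.CriticalPhenomena.PercolationContinuityZ3.Theorems
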